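import Literature.AlgebraicGeometry.Resolution.WeightedCentreTheoremAPlusLight
import Literature.AlgebraicGeometry.Resolution.WeightedCentreSlotPinnedClass
import HarnessLib

/-!
# Weighted centres — THEOREM A⁺ for a light bottom class, with (P) at the CLASS (engine's formulation)

Instrument for engine 1's `W(f)` TOY MODEL (cell `pub-rosobs`, LF-MODEL-eng1-g45 §6.2 THEOREM A⁺ as the engine states it: "(P) at `L₁`" ⇒ "every `X ∈ Iso(N, g)` fixes every slot
of `L₁`"), NOT a resolution theorem and NOT about the invariant of [AbramovichTemkinWlodarczyk2024].

`apply_CX_eq_of_slotPinned_class` = `apply_CX_eq_of_slotPinned` (slot-level, `WeightedCentreTheoremAPlusLight`) + `SlotPinned.of_weight_eq` ((P) is a condition on the weight class,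
`WeightedCentreSlotPinnedClass`): if `g` is (P)-pinned at ONE slot `l` of the bottom class (`w l` minimal, `w l = r ∈ {1, …, p − 1}`), then every graded `k[σ]`-automorphism
`X₀ ≡ id (mod σ)` fixing `ε_V` (`V ⊇` the slots of weight `> p + 1`) and `g` fixes EVERY slot of weight `w l`.

References: [Lang2002, Ch. IV §1, Ch. XIII §4]; [Matsumura1987, §27]; [AbramovichTemkinWlodarczyk2024, §5.1 (p. 1575), Thm. 5.3.1 (2)–(3) (p. 1578)].
-/

namespace Literature.AlgebraicGeometry.Resolution.WeightedBlowup.BottomClimb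

open Polynomial OrderFiltration LevelProjection ZKernel Truncation

variable {k : Type*} [Field k] {ι : Type*} [Fintype ι] [DecidableEq ι] {w : ι → ℚ} {p : ℕ} [Fact p.Prime] [CharP k p] {u : ℕ → k}

/-- **THEOREM A⁺ (light bottom class; (P) at the class)** — LF-MODEL-eng1-g45 §6.2: weights `≥ 0`, every slot of weight `> p + 1` in `V`, `b!·u_b = 1 (b < p)`; if `g` is
(P)-pinned at a slot `l` of minimal weight `w l = r`, `1 ≤ r ≤ p − 1`, then a graded `k[σ]`-automorphism `X₀ ≡ id (mod σ)` fixing `ε_V` and `g` fixes every slot `z` with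
`w z = w l` (the whole bottom class `L₁`).  Instrument for engine 1's `W(f)` toy model, NOT a resolution theorem.
[cite: AbramovichTemkinWlodarczyk2024, §5.1 (p. 1575), Thm. 5.3.1 (2)–(3) (p. 1578); Lang2002, Ch. IV §1, Ch. XIII §4; Matsumura1987, §27] -/
theorem apply_CX_eq_of_slotPinned_class (hu : ∀ n < p, (Nat.factorial n : k) * u n = 1) (hw : ∀ i, 0 ≤ w i) {V : Set ι}
    (hVw : ∀ i, w i ≤ (p : ℚ) + 1 ∨ i ∈ V) {X₀ : (MvPolynomial ι k)[X] ≃+* (MvPolynomial ι k)[X]} (hg : X₀ ∈ graded w (1 : ℚ))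
    (hb : X₀ ∈ baseFixing) (h1 : X₀ ∈ level (X : (MvPolynomial ι k)[X]) 1) (hV : X₀ ∈ fixSlots V) {g : MvPolynomial ι k}
    (hfix : X₀ (C g) = C g) {l : ι} (hmin : ∀ j, w l ≤ w j) {r : ℕ} (hwl : w l = r) (hr1 : 1 ≤ r) (hrp : r ≤ p - 1)
    (hP : SlotPinned w l g) {z : ι} (hz : w z = w l) : X₀ (C (MvPolynomial.X z)) = C (MvPolynomial.X z) :=
  apply_CX_eq_of_slotPinned hu hw hVw hg hb h1 hV hfix (fun j => by rw [hz]; exact hmin j) (hz.trans hwl) hr1 hrp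
    (hP.of_weight_eq w hz)

/-- **THEOREM A⁺, subgroup form**: under the hypotheses of `apply_CX_eq_of_slotPinned_class`, `X₀` lies in `fixSlots {z | w z = w l}` (it fixes `ε_{L₁}`).
Instrument for engine 1's `W(f)` toy model, NOT a resolution theorem. [cite: AbramovichTemkinWlodarczyk2024, §5.1 (p. 1575), Thm. 5.3.1 (2)–(3) (p. 1578); Lang2002, Ch. XIII §4] -/
theorem mem_fixSlots_class_of_slotPinned (hu : ∀ n < p, (Nat.factorial n : k) * u n = 1) (hw : ∀ i, 0 ≤ w i) {V : Set ι}
    (hVw : ∀ i, w i ≤ (p : ℚ) + 1 ∨ i ∈ V) {X₀ : (MvPolynomial ι k)[X] ≃+* (MvPolynomial ι k)[X]} (hg : X₀ ∈ graded w (1 : ℚ))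
    (hb : X₀ ∈ baseFixing) (h1 : X₀ ∈ level (X : (MvPolynomial ι k)[X]) 1) (hV : X₀ ∈ fixSlots V) {g : MvPolynomial ι k}
    (hfix : X₀ (C g) = C g) {l : ι} (hmin : ∀ j, w l ≤ w j) {r : ℕ} (hwl : w l = r) (hr1 : 1 ≤ r) (hrp : r ≤ p - 1)
    (hP : SlotPinned w l g) : X₀ ∈ fixSlots {z | w z = w l} :=
  mem_fixSlots.mpr fun _ hz => apply_CX_eq_of_slotPinned_class hu hw hVw hg hb h1 hV hfix hmin hwl hr1 hrp hP hz

end Literature.AlgebraicGeometry.Resolution.WeightedBlowup.BottomClimb
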